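/-
Copyright: statement-level skeleton of a published paper (lit-balaban cell, Phase-2 proof seat p32 gen 46). No claims beyond
what the kernel checks below.
-/
import Literature.MathematicalPhysics.QuantumFieldTheory.Balaban1983to89.B3OnePIChainClasses
import Literature.MathematicalPhysics.QuantumFieldTheory.Balaban1983to89.B3GraphRelabelling

/-!
# B3 — T. Bałaban, *(Higgs)₂,₃ quantum fields in a finite volume. III. Renormalization*, CMP **88** (1983) 411–445
[Balaban1983Higgs3] — p. 416 [PDF 6] (1.21)–(1.22): THE SYMMETRY NUMBER OF A CHAIN IS THE PRODUCT OF THE SYMMETRY NUMBERS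
OF ITS ONE-PARTICLE-IRREDUCIBLE PIECES — restriction to the blocks is a group isomorphism
`Aut(chain P [l₁, …, l_r]) ≃* Π_{k ≤ r} Aut(letter k)`; for every unglueable two-leg insertion `|Aut T| = Π_k |Aut V_k|`
over its pieces; hence (FILE 2's orbit–stabilizer) the labelled count of the class of a chain on `V` vertices is
`V!/Π_k |Aut V_k|`, and on isomorphism classes the symmetry number factorizes through gen 44's index bijection `classEquiv`
of the regrouping (1.21)

statement-level skeleton of published theorems with citation tags; proofs where landed; nothing here is a claim about
the Yang–Mills mass gap

PDF held: `paper:balaban1983-higgs-2-3-quantum-fields-finite-volume` (journal page = PDF page + 410); p. 416 read as image on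
the ×2 render `run/shared/lean/pub/pub-balaban/b2b-balaban-ref1/pages/1983-cmp88-higgs23-III/1983-cmp88-higgs23-III-p006-x2.png`.

CITATION HEADER (lean-in-tree rule).  lit-balaban TYPED SKELETON (HOME `run/shared/lean/pub/lit-balaban/`), PHASE 2, seat p32
gen 46 (unit `lit-balaban-p32`; TAKING #2 line HOME/STATUS.md 2026-08-24T16:49Z, free-target protocol G.5-34(d)), row
**B3.Eq1.19-1.22** ((1.21)–(1.22), p. 416) of `HOME/lit-balaban-r15/ROWS-B3.md` (fold owner r15; head `proved` under the lead
g12 HEAD WORD Q25; this file is an OPTIONAL located member of its (1.21) cell, zero head weight — it supplies the item the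
gen-44 HONEST SCOPE (iv) of `B3OnePIChainClasses` names as absent: *"No symmetry factors"*).  CONSUMES BY NAME: p37's
`B3OnePIChainGlue.TwoLegGraph` / `chain` ((1.21)), gen 43's `B3OnePIChainBlocks` (`letter`, `blockEmb`, `blockEmb_injective`,
`exists_blockEmb_eq`), gen 44's `B3GraphIso.TwoLegGraphIso`, `B3OnePIChainPieceGraphs` (`piece`, `pieceEmb`, `pieceIdx`,
`Unglueable`), `B3OnePIChainUnglue` (`unglueVert_eq`, `unglueable_chain`, `numSep_chain_of_letters`,
`level_chain_blockEmb_of_letters`, `isoChainPieces`, `headPiece` / `tailPieces` / `letter_pieces`, `isLetter_letter_pieces`,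
`IsLetter`) and `B3OnePIChainClasses` (`pieceIsoLetter`, `blockEmb_letterVert`, `chainIsoOfLetterIsos`, `IsoClass` / `mkC` /
`rep` / `repIso`, `LetterClass` / `UnglueableClass`, `glue`, `classEquiv`, `letter_rep_succ`, `isLetter_letter_rep`), FILE 2
`B3GraphRelabelling` (`autGroupTL`, `autTL_mul_def`, `toEquiv_transTL`, `twoLegGraphIso_ext`, `graphIso_ext`,
`card_autTL_eq_of_iso`, `card_autTL_dvd_factorial`, `card_twoLegGraphIso_self_pos`, `TwoLegOn`, `ncard_isoTL_mul_card_aut`,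
`ncard_isoTL_eq_factorial_div`); Mathlib's `MonoidHom`, `MulEquiv.ofBijective`, `Nat.card_pi`, `Fin.prod_univ_succ`,
`List.prod_ofFn`.  Nothing re-declared; no declaration is added to another file's namespace.

THE PRINTED TEXT (verbatim).  p. 416: *"The function G^ε has a perturbative expansion of the following structure
G^ε = Σ_{n=0}^∞ C₀^ε[(−δm² + Σ^ε + ∂^{ε*}Σ₁^ε + Σ₁^{ε*}∂^ε + ∂^{ε*}Σ₂^ε∂^ε)C₀^ε]ⁿ, (1.21) where C₀^ε = (−Δ₀^ε + m²)^{−1}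
and Σ^ε, Σ₁^ε, Σ₂^ε are given by amputated, one-particle-irreducible graphs of the expansion of G^ε."*  p. 416, after
(1.22): *"Here we did not write, and we will not write in the future, combinatoric factors before the graphs, understanding that
they are a part of the graphical description."*

KIND «(ours)» (G.5-54): print states the Dyson regrouping (1.21) of the connected two-point graphs by their strings of
one-particle-irreducible pieces with the combinatoric factors understood.  For the regrouping to be consistent with those
factors, the factor of a chain must be the product of the factors of its pieces; at the level of VERTEX LABELS (FILE 2's
reading) this is the statement proved here: the rigid automorphisms of a chain are exactly the tuples of rigid automorphisms
of its pieces (the separating `C₀^ε`-lines are canonical — an isomorphism preserves levels — so no symmetry mixes the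
pieces), whence the symmetry numbers `|Aut|` and the labelled counts `V!/|Aut|` multiply.  Each declaration's cite tag is a CONTEXT locator,
not a transcription.

WHAT IS PROVED (theorems + six `noncomputable def`s with bodies: `res`, `resHom`, `glueAut`, `autChainMulEquiv`,
`autMulEquivPieces`, `autCard`;
no `Prop` fact, no `sorry`; standard axioms).  For a chain `chain P l` of LETTERS
(`hl : ∀ k ≤ l.length, IsLetter (letter P l k)`):
* `§1` `le_numSep_chain`; **`res hl e k hk : Aut(letter k)`** (restriction of `e : Aut(chain P l)` to block `k`, through
  `pieceIsoLetter` along `e` and along the identity), `blockEmb_pieceIsoLetter_refl`, **`blockEmb_res`**: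
  `blockEmb k ((res e k) v) = e (blockEmb k v)`, `autTL_ext_blockEmb`, **`res_mul`**, `res_one`, **`resHom`** (the
  homomorphism `Aut(chain P l) →* Π_{k : Fin (r+1)} Aut(letter k)`), `resHom_apply`, **`resHom_injective`**.
* `§2` **`glueAut`** (`chainIsoOfLetterIsos` on a tuple of letter automorphisms), **`toEquiv_glueAut_blockEmb`**:
  `glueAut a (blockEmb k v) = blockEmb k (a_k v)`, **`res_glueAut`**, `resHom_surjective`, **`autChainMulEquiv :
  Aut(chain P l) ≃* Π_k Aut(letter k)`** (`autChainMulEquiv_apply`), **`card_aut_chain`**: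
  `|Aut(chain P l)| = Π_k |Aut(letter k)|`, `card_aut_chain_eq_one`, `card_aut_letter_dvd_card_aut_chain`.
* `§3` for every UNGLUEABLE insertion `T` (gen 44): **`card_aut_eq_prod_pieces`**:
  `|Aut T| = Π_{k ≤ numSep T} |Aut(piece k)|`, `card_aut_piece_dvd`, `le_numSep_of_lt_length_tailPieces`,
  **`autMulEquivPieces : Aut T ≃* Π_k Aut(piece k)`** (group level, index `Fin ((tailPieces T hU).length + 1)`), `card_aut_eq_one_of_pieces`.
* `§4` with FILE 2's orbit–stabilizer on the `V` labelled vertices: **`ncard_iso_mul_prod_card_aut_pieces`**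
  (`#{T′ ≅ T} · Π_k |Aut V_k| = V!`), `ncard_iso_eq_factorial_div_prod`, `prod_card_aut_pieces_dvd_factorial`.
* `§5` on classes: **`autCard q`** (symmetry number of a class; `autCard_mkC`, `autCard_pos`), **`autCard_glue`**
  (`autCard (glue (c, cs)) = autCard c · Π autCard cᵢ`), **`autCard_eq_prod_classEquiv`** (the symmetry number factorizes
  through the index bijection `classEquiv` of (1.21)), `autCard_classEquiv_symm`.

HONEST SCOPE.  (i) As in FILE 2 / FILE C: the automorphisms are the RIGID ones (`TwoLegGraphIso`: kind-preserving vertex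
bijections whose induced leg map preserves the pairing AND fixes the two marked external legs); `|Aut|` is the
vertex-relabelling symmetry number, not the textbook Feynman factor (leg/line permutations, `1/n!`, vertex normalisations
are not modelled) — reading `V!/|Aut|` as "the combinatoric factor" is a READING of p. 416 restricted to vertex labels.
(ii) Only UNGLUEABLE insertions (connected, separating lines scalar, pieces spanning lines — gen 44) are covered: two-point
graphs through a bare `−δm²` vertex (1.7) or with a vector separating line are outside `Unglueable` (HONEST SCOPE of
`B3OnePIChainUnglue`).  (iii) For `T` itself the group isomorphism `autMulEquivPieces` is indexed by `Fin ((tailPieces T hU).length + 1)`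
(propositionally `= Fin (numSep T + 1)`, `length_tailPieces`) to avoid a dependent reindexing; the counting statements of
`§3`–`§4` are indexed by `Fin (numSep T + 1)` directly.
(iv) WHERE THE HYPOTHESES ENTER (owner's ask): `§1`–`§2` assume the letters IRREDUCIBLE (`IsLetter`: connected and proper
between their ports — the MAXIMAL decomposition of (1.21) into one-particle-irreducible pieces), because the restriction to a
block is read through gen 44's `pieceIsoLetter`, which identifies the pieces of the chain with the given letters only then;
the restriction map exists mathematically for any decomposition into connected letters (isomorphisms preserve levels, hence
every union of consecutive pieces), but that generality is NOT constructed here.  `§3`–`§5` need `Unglueable T` (gen 44) for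
`T` to HAVE pieces `V_0, …, V_m` at all; the product formula is over THAT maximal decomposition and must not be read for an
arbitrary splitting of `T` into sub-insertions.  (v) Nothing analytic; no amplitude is attached.
-/

namespace Literature.MathematicalPhysics.QuantumFieldTheory.Balaban1983to89.B3OnePIChainAut

open Finset B3Prop1 B3Cor23Concrete B3OnePIGraphs B3OnePIChainDecomposition B3OnePIChainPieces B3GraphGlueLegs
  B3GraphGlue B3OnePIChainGlue B3OnePIChainBlocks B3GraphIso B3OnePIChainPieceGraphs B3OnePIChainUnglue
  B3OnePIChainClasses B3GraphRelabelling

variable {nbar : ℕ}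

/-- `Lv T v`: the level of the vertex `v` of `T` between its ports (local notation, as in the prequels). -/
local notation:max "Lv " T:max =>
  level (TwoLegGraph.G T) (Sigma.fst (TwoLegGraph.legIn T)) (Sigma.fst (TwoLegGraph.legOut T))

/-- `Ns T`: the number of separating lines between the ports of `T` (local notation, as in the prequels). -/
local notation:max "Ns " T:max =>
  numSep (TwoLegGraph.G T) (Sigma.fst (TwoLegGraph.legIn T)) (Sigma.fst (TwoLegGraph.legOut T))

/-! ## §1 Restricting an automorphism of a chain of letters to a block -/

section Chain

variable {P : TwoLegGraph nbar} {l : List (TwoLegGraph nbar)} (hl : ∀ k ≤ l.length, IsLetter (letter P l k))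
include hl

/-- kernel: `k ≤ r` letters ⇒ `k ≤ numSep (chain)`. [cite: Balaban1983Higgs3, (1.21) p.416] -/
theorem le_numSep_chain {k : ℕ} (hk : k ≤ l.length) : k ≤ Ns (chain P l) := by
  rw [numSep_chain_of_letters hl]; exact hk

/-- **THE RESTRICTION OF AN AUTOMORPHISM OF A CHAIN OF LETTERS TO ITS `k`-TH LETTER** («(ours)»): an automorphism `e` of
`chain P [l₁, …, l_r]` (rigid isomorphism of two-leg insertions, `B3GraphIso.TwoLegGraphIso`) preserves levels, hence maps
the `k`-th block onto itself; read on the letter through gen 44's `pieceIsoLetter` (piece `k` of the chain ≅ letter `k`,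
once along `e` and once along the identity) — this is where the letters must be irreducible (`hl`: the maximal
decomposition; for coarser letters the pieces of the chain are finer than the letters). [cite: Balaban1983Higgs3, (1.21) p.416] -/
noncomputable def res (e : TwoLegGraphIso (chain P l) (chain P l)) (k : ℕ) (hk : k ≤ l.length) :
    TwoLegGraphIso (letter P l k) (letter P l k) :=
  (pieceIsoLetter hl (unglueable_chain hl) (TwoLegGraphIso.refl (chain P l)) k (le_numSep_chain hl hk)).symm.trans
    (pieceIsoLetter hl (unglueable_chain hl) e k (le_numSep_chain hl hk))

/-- kernel: the identity transcription piece `k` ≅ letter `k` is the inverse of the block embedding on vertices.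
[cite: Balaban1983Higgs3, (1.21) p.416] -/
theorem blockEmb_pieceIsoLetter_refl {k : ℕ} (hk : k ≤ l.length) (u : Fin (pieceCard (chain P l) k)) :
    blockEmb P l k ((pieceIsoLetter hl (unglueable_chain hl) (TwoLegGraphIso.refl (chain P l)) k
      (le_numSep_chain hl hk)).toEquiv u) = pieceEmb (chain P l) k u :=
  blockEmb_letterVert hl (TwoLegGraphIso.refl (chain P l)) k u

/-- **THE VERTEX MAP OF THE RESTRICTION, computed**: embedded back into the chain, `res e k` IS `e` on the `k`-th block —
`blockEmb k ((res e k) v) = e (blockEmb k v)`. [cite: Balaban1983Higgs3, (1.21) p.416] -/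
theorem blockEmb_res (e : TwoLegGraphIso (chain P l) (chain P l)) {k : ℕ} (hk : k ≤ l.length)
    (v : Fin (letter P l k).G.nV) :
    blockEmb P l k ((res hl e k hk).toEquiv v) = e.toEquiv (blockEmb P l k v) := by
  set c₀ := pieceIsoLetter hl (unglueable_chain hl) (TwoLegGraphIso.refl (chain P l)) k (le_numSep_chain hl hk) with hc₀
  set u := c₀.toEquiv.symm v with hu
  have h0 : blockEmb P l k v = pieceEmb (chain P l) k u := by
    have h := blockEmb_pieceIsoLetter_refl hl hk u
    rwa [hu, Equiv.apply_symm_apply] at h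
  show blockEmb P l k ((pieceIsoLetter hl (unglueable_chain hl) e k (le_numSep_chain hl hk)).toEquiv (c₀.toEquiv.symm v)) = _
  rw [← hu, h0]
  exact blockEmb_letterVert hl e k u

omit hl in
/-- kernel: two automorphisms of a letter agreeing after the block embedding are equal. [cite: Balaban1983Higgs3, (1.21) p.416] -/
theorem autTL_ext_blockEmb {k : ℕ} {a b : TwoLegGraphIso (letter P l k) (letter P l k)}
    (h : ∀ v, blockEmb P l k (a.toEquiv v) = blockEmb P l k (b.toEquiv v)) : a = b :=
  twoLegGraphIso_ext (graphIso_ext (Equiv.ext fun v => blockEmb_injective P l k (h v)))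

/-- **Restriction is multiplicative**: `res (e ∘ e′) k = res e k ∘ res e′ k`. [cite: Balaban1983Higgs3, (1.21) p.416] -/
theorem res_mul (e e' : TwoLegGraphIso (chain P l) (chain P l)) {k : ℕ} (hk : k ≤ l.length) :
    res hl (e * e') k hk = res hl e k hk * res hl e' k hk := by
  refine autTL_ext_blockEmb fun v => ?_
  rw [blockEmb_res, autTL_mul_def, autTL_mul_def, toEquiv_transTL, toEquiv_transTL, Equiv.trans_apply, Equiv.trans_apply,
    blockEmb_res, blockEmb_res]

/-- kernel: the restriction of the identity is the identity. [cite: Balaban1983Higgs3, (1.21) p.416] -/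
theorem res_one {k : ℕ} (hk : k ≤ l.length) : res hl (1 : TwoLegGraphIso (chain P l) (chain P l)) k hk = 1 := by
  refine autTL_ext_blockEmb fun v => ?_
  rw [blockEmb_res]
  rfl

/-- **RESTRICTION TO THE BLOCKS AS A GROUP HOMOMORPHISM** `Aut(chain P l) →* Π_{k ≤ r} Aut(letter k)` («(ours)»; the
automorphism groups are FILE 2's `autGroupTL`). [cite: Balaban1983Higgs3, (1.21) p.416] -/
noncomputable def resHom :
    TwoLegGraphIso (chain P l) (chain P l) →* ∀ k : Fin (l.length + 1), TwoLegGraphIso (letter P l k) (letter P l k) where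
  toFun e k := res hl e k (Nat.le_of_lt_succ k.2)
  map_one' := funext fun k => res_one hl (Nat.le_of_lt_succ k.2)
  map_mul' e e' := funext fun k => res_mul hl e e' (Nat.le_of_lt_succ k.2)

/-- kernel: the components of `resHom`. [cite: Balaban1983Higgs3, (1.21) p.416] -/
theorem resHom_apply (e : TwoLegGraphIso (chain P l) (chain P l)) (k : Fin (l.length + 1)) :
    resHom hl e k = res hl e k (Nat.le_of_lt_succ k.2) := rfl

/-- **An automorphism of a chain is determined by its restrictions to the blocks** (every vertex of the chain lies in a
block, gen 43's `exists_blockEmb_eq`): `resHom` is injective. [cite: Balaban1983Higgs3, (1.21) p.416] -/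
theorem resHom_injective : Function.Injective (resHom hl) := by
  refine (injective_iff_map_eq_one (resHom hl)).mpr fun e he => ?_
  refine twoLegGraphIso_ext (graphIso_ext (Equiv.ext fun w => ?_))
  obtain ⟨k, hk, v, rfl⟩ := exists_blockEmb_eq P l w
  have h := blockEmb_res hl e hk v
  have hk' : res hl e k hk = 1 := by
    have := congrFun he ⟨k, Nat.lt_succ_of_le hk⟩
    exact this
  rw [hk'] at h
  exact h.symm

/-! ## §2 Gluing letter automorphisms; restriction is an isomorphism of groups -/

/-- **GLUING AUTOMORPHISMS OF THE LETTERS INTO AN AUTOMORPHISM OF THE CHAIN** («(ours)»): gen 44's `chainIsoOfLetterIsos` fed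
with one automorphism per letter. [cite: Balaban1983Higgs3, (1.21) p.416] -/
noncomputable def glueAut (a : ∀ k : Fin (l.length + 1), TwoLegGraphIso (letter P l k) (letter P l k)) :
    TwoLegGraphIso (chain P l) (chain P l) :=
  chainIsoOfLetterIsos rfl hl fun k hk => a ⟨k, Nat.lt_succ_of_le hk⟩

/-- **THE VERTEX MAP OF THE GLUED AUTOMORPHISM, computed**: on the `k`-th block it is the `k`-th letter automorphism —
`glueAut a (blockEmb k v) = blockEmb k (a_k v)`. [cite: Balaban1983Higgs3, (1.21) p.416] -/
theorem toEquiv_glueAut_blockEmb (a : ∀ k : Fin (l.length + 1), TwoLegGraphIso (letter P l k) (letter P l k))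
    {k : ℕ} (hk : k ≤ l.length) (v : Fin (letter P l k).G.nV) :
    (glueAut hl a).toEquiv (blockEmb P l k v) = blockEmb P l k ((a ⟨k, Nat.lt_succ_of_le hk⟩).toEquiv v) := by
  have hkN : k ≤ Ns (chain P l) := le_numSep_chain hl hk
  have hlv : Lv (chain P l) (blockEmb P l k v) = k := level_chain_blockEmb_of_letters hl hk v
  show unglueVert _ (blockEmb P l k v) = _
  rw [unglueVert_eq _ hlv hkN]
  show blockEmb P l k ((a ⟨k, _⟩).toEquiv ((pieceIsoLetter hl (unglueable_chain hl) (TwoLegGraphIso.refl (chain P l)) k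
    hkN).toEquiv (pieceIdx (blockEmb P l k v) hlv))) = _
  congr 2
  apply blockEmb_injective P l k
  rw [blockEmb_pieceIsoLetter_refl hl hk, pieceEmb_pieceIdx]

/-- **Restriction undoes gluing**: `res (glueAut a) k = a_k`. [cite: Balaban1983Higgs3, (1.21) p.416] -/
theorem res_glueAut (a : ∀ k : Fin (l.length + 1), TwoLegGraphIso (letter P l k) (letter P l k)) (k : Fin (l.length + 1)) :
    res hl (glueAut hl a) k (Nat.le_of_lt_succ k.2) = a k := by
  refine autTL_ext_blockEmb fun v => ?_
  rw [blockEmb_res, toEquiv_glueAut_blockEmb hl a (Nat.le_of_lt_succ k.2)]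

/-- kernel: `resHom` is surjective — every family of letter automorphisms is the restriction of its gluing.
[cite: Balaban1983Higgs3, (1.21) p.416] -/
theorem resHom_surjective : Function.Surjective (resHom hl) :=
  fun a => ⟨glueAut hl a, funext fun k => res_glueAut hl a k⟩

/-- **THE AUTOMORPHISM GROUP OF A CHAIN OF LETTERS IS THE PRODUCT OF THE AUTOMORPHISM GROUPS OF ITS LETTERS** («(ours)»):
`Aut(chain P [l₁, …, l_r]) ≃* Π_{k ≤ r} Aut(letter k)` by restriction to the blocks — the separating `C₀^ε`-lines of
(1.21) are canonical (levels are preserved), so a symmetry of the chain is exactly a symmetry of each one-particle-irreducible piece.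
[cite: Balaban1983Higgs3, (1.21) p.416] -/
noncomputable def autChainMulEquiv :
    TwoLegGraphIso (chain P l) (chain P l) ≃* ∀ k : Fin (l.length + 1), TwoLegGraphIso (letter P l k) (letter P l k) :=
  MulEquiv.ofBijective (resHom hl) ⟨resHom_injective hl, resHom_surjective hl⟩

/-- kernel: the components of `autChainMulEquiv`. [cite: Balaban1983Higgs3, (1.21) p.416] -/
theorem autChainMulEquiv_apply (e : TwoLegGraphIso (chain P l) (chain P l)) (k : Fin (l.length + 1)) :
    autChainMulEquiv hl e k = res hl e k (Nat.le_of_lt_succ k.2) := rfl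

/-- **THE SYMMETRY NUMBER OF A CHAIN IS THE PRODUCT OF THE SYMMETRY NUMBERS OF ITS LETTERS**:
`|Aut(chain P [l₁, …, l_r])| = Π_{k ≤ r} |Aut(letter k)|` (FILE 2's rigid vertex-relabelling symmetry numbers
`Nat.card (TwoLegGraphIso · ·)`). [cite: Balaban1983Higgs3, (1.21)–(1.22) p.416] -/
theorem card_aut_chain :
    Nat.card (TwoLegGraphIso (chain P l) (chain P l)) =
      ∏ k : Fin (l.length + 1), Nat.card (TwoLegGraphIso (letter P l k) (letter P l k)) := by
  rw [Nat.card_congr (autChainMulEquiv hl).toEquiv, Nat.card_pi]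

/-- kernel: in particular a chain of RIGID letters (trivial automorphism groups) is rigid.
[cite: Balaban1983Higgs3, (1.21)–(1.22) p.416] -/
theorem card_aut_chain_eq_one (h1 : ∀ k ≤ l.length, Nat.card (TwoLegGraphIso (letter P l k) (letter P l k)) = 1) :
    Nat.card (TwoLegGraphIso (chain P l) (chain P l)) = 1 := by
  rw [card_aut_chain hl]
  exact Finset.prod_eq_one fun k _ => h1 k (Nat.le_of_lt_succ k.2)

/-- kernel: the symmetry number of each letter divides that of the chain. [cite: Balaban1983Higgs3, (1.21)–(1.22) p.416] -/
theorem card_aut_letter_dvd_card_aut_chain (k : Fin (l.length + 1)) :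
    Nat.card (TwoLegGraphIso (letter P l k) (letter P l k)) ∣ Nat.card (TwoLegGraphIso (chain P l) (chain P l)) := by
  rw [card_aut_chain hl]
  exact Finset.dvd_prod_of_mem _ (Finset.mem_univ k)

end Chain

/-! ## §3 Unglueable insertions: the symmetry number is the product over the pieces -/

section Pieces

variable {T : TwoLegGraph nbar}

/-- **THE SYMMETRY NUMBER OF A CONNECTED TWO-POINT INSERTION IS THE PRODUCT OF THE SYMMETRY NUMBERS OF ITS
ONE-PARTICLE-IRREDUCIBLE PIECES**: for every unglueable `T` (gen 44: connected, separating lines scalar, pieces spanning —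
the insertions that (1.21) regroups), `|Aut T| = Π_{k ≤ m} |Aut V_k|` over its pieces `V_0, …, V_m` (`m = numSep T`), through
`T ≅ chain V_0 [V_1, …, V_m]` (`isoChainPieces`) and FILE 2's `card_autTL_eq_of_iso`.
[cite: Balaban1983Higgs3, (1.21)–(1.22) p.416] -/
theorem card_aut_eq_prod_pieces (hU : Unglueable T) :
    Nat.card (TwoLegGraphIso T T) =
      ∏ k : Fin (Ns T + 1), Nat.card (TwoLegGraphIso (piece T hU k (Nat.le_of_lt_succ k.2))
        (piece T hU k (Nat.le_of_lt_succ k.2))) := by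
  have hl : ∀ k ≤ (tailPieces T hU).length, IsLetter (letter (headPiece T hU) (tailPieces T hU) k) :=
    isLetter_letter_pieces T hU
  rw [card_autTL_eq_of_iso (isoChainPieces T hU), card_aut_chain hl]
  have hlen : (tailPieces T hU).length + 1 = Ns T + 1 := by rw [length_tailPieces]
  rw [← Equiv.prod_comp (finCongr hlen).symm]
  refine Finset.prod_congr rfl fun k _ => ?_
  have hk : (k : ℕ) ≤ Ns T := Nat.le_of_lt_succ k.2
  simp only [finCongr_symm, finCongr_apply, Fin.val_cast]
  rw [letter_pieces T hU k hk]

/-- kernel: the symmetry number of each piece divides that of the insertion. [cite: Balaban1983Higgs3, (1.21)–(1.22) p.416] -/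
theorem card_aut_piece_dvd (hU : Unglueable T) (k : ℕ) (hk : k ≤ Ns T) :
    Nat.card (TwoLegGraphIso (piece T hU k hk) (piece T hU k hk)) ∣ Nat.card (TwoLegGraphIso T T) := by
  have hl : ∀ k ≤ (tailPieces T hU).length, IsLetter (letter (headPiece T hU) (tailPieces T hU) k) :=
    isLetter_letter_pieces T hU
  have hk' : k < (tailPieces T hU).length + 1 := by rw [length_tailPieces]; exact Nat.lt_succ_of_le hk
  rw [card_autTL_eq_of_iso (isoChainPieces T hU), ← letter_pieces T hU k hk]
  exact card_aut_letter_dvd_card_aut_chain hl ⟨k, hk'⟩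

/-- kernel: an insertion all of whose pieces are rigid is rigid. [cite: Balaban1983Higgs3, (1.21)–(1.22) p.416] -/
theorem card_aut_eq_one_of_pieces (hU : Unglueable T)
    (h1 : ∀ k (hk : k ≤ Ns T), Nat.card (TwoLegGraphIso (piece T hU k hk) (piece T hU k hk)) = 1) :
    Nat.card (TwoLegGraphIso T T) = 1 := by
  rw [card_aut_eq_prod_pieces hU]
  exact Finset.prod_eq_one fun k _ => h1 k (Nat.le_of_lt_succ k.2)

/-- kernel: an index below `(tailPieces T hU).length + 1` is a piece index `≤ numSep T`. [cite: Balaban1983Higgs3, (1.21) p.416] -/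
theorem le_numSep_of_lt_length_tailPieces (hU : Unglueable T) (k : Fin ((tailPieces T hU).length + 1)) : (k : ℕ) ≤ Ns T := by
  have h : (k : ℕ) < (tailPieces T hU).length + 1 := k.2
  have hl : (tailPieces T hU).length = Ns T := length_tailPieces T hU
  omega

/-- **THE AUTOMORPHISM GROUP OF AN UNGLUEABLE INSERTION IS THE PRODUCT OF THE AUTOMORPHISM GROUPS OF ITS PIECES** («(ours)»,
group level of `card_aut_eq_prod_pieces`): `Aut T ≃* Π_k Aut V_k`, composed of FILE 2's conjugation `autCongrTL
(isoChainPieces T hU)` (`Aut T ≃* Aut(chain of the pieces)`), `autChainMulEquiv`, and letterwise the conjugation by gen 44's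
`isoOfEq (letter_pieces …)` (letter `k` of that chain IS piece `k`).  The index runs over `Fin ((tailPieces T hU).length + 1)`
(`= Fin (numSep T + 1)` by `length_tailPieces`). [cite: Balaban1983Higgs3, (1.21)–(1.22) p.416] -/
noncomputable def autMulEquivPieces (hU : Unglueable T) :
    TwoLegGraphIso T T ≃* ∀ k : Fin ((tailPieces T hU).length + 1),
      TwoLegGraphIso (piece T hU k (le_numSep_of_lt_length_tailPieces hU k))
        (piece T hU k (le_numSep_of_lt_length_tailPieces hU k)) :=
  ((autCongrTL (isoChainPieces T hU)).trans (autChainMulEquiv (isLetter_letter_pieces T hU))).trans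
    (MulEquiv.piCongrRight fun k =>
      autCongrTL (isoOfEq (letter_pieces T hU k (le_numSep_of_lt_length_tailPieces hU k))))

end Pieces

/-! ## §4 The labelled count of a chain class (orbit–stabilizer of FILE 2) -/

section Labelled

variable {V : ℕ}

/-- **THE COMBINATORIC FACTOR OF A CHAIN FACTORS OVER ITS PIECES, at the level of vertex labels** («(ours)»; the
combinatorial half of why the Dyson regrouping (1.21) is compatible with the unwritten *"combinatoric factors"*): the
number of insertions on the `V` labelled vertices isomorphic to an unglueable `T`, times the PRODUCT of the symmetry numbers
of the pieces of `T`, is `V!` (FILE 2's `ncard_isoTL_mul_card_aut` with `§3`).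
[cite: Balaban1983Higgs3, (1.21)–(1.22) p.416] -/
theorem ncard_iso_mul_prod_card_aut_pieces (T : TwoLegOn nbar V) (hU : Unglueable T.1) :
    {T' : TwoLegOn nbar V | Nonempty (TwoLegGraphIso T'.1 T.1)}.ncard *
        ∏ k : Fin (Ns T.1 + 1), Nat.card (TwoLegGraphIso (piece T.1 hU k (Nat.le_of_lt_succ k.2))
          (piece T.1 hU k (Nat.le_of_lt_succ k.2))) = V.factorial := by
  rw [← card_aut_eq_prod_pieces hU]
  exact ncard_isoTL_mul_card_aut T

/-- kernel: hence the labelled count of the class of an unglueable insertion is `V! / Π_k |Aut V_k|` (exact division).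
[cite: Balaban1983Higgs3, (1.21)–(1.22) p.416] -/
theorem ncard_iso_eq_factorial_div_prod (T : TwoLegOn nbar V) (hU : Unglueable T.1) :
    {T' : TwoLegOn nbar V | Nonempty (TwoLegGraphIso T'.1 T.1)}.ncard =
      V.factorial / ∏ k : Fin (Ns T.1 + 1), Nat.card (TwoLegGraphIso (piece T.1 hU k (Nat.le_of_lt_succ k.2))
        (piece T.1 hU k (Nat.le_of_lt_succ k.2))) := by
  rw [← card_aut_eq_prod_pieces hU]
  exact ncard_isoTL_eq_factorial_div T

/-- kernel: the product of the symmetry numbers of the pieces of an insertion with `V` vertices divides `V!`.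
[cite: Balaban1983Higgs3, (1.21)–(1.22) p.416] -/
theorem prod_card_aut_pieces_dvd_factorial (T : TwoLegGraph nbar) (hU : Unglueable T) :
    ∏ k : Fin (Ns T + 1), Nat.card (TwoLegGraphIso (piece T hU k (Nat.le_of_lt_succ k.2))
      (piece T hU k (Nat.le_of_lt_succ k.2))) ∣ (T.G.nV).factorial := by
  rw [← card_aut_eq_prod_pieces hU]
  exact card_autTL_dvd_factorial T

end Labelled

/-! ## §5 The symmetry number as a function on isomorphism classes -/

section Classes

/-- **THE SYMMETRY NUMBER OF AN ISOMORPHISM CLASS of two-leg insertions** («(ours)»): the number of (rigid) automorphisms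
of gen 44's chosen representative `rep q` — independent of the representative by FILE 2's `card_autTL_eq_of_iso`
(`autCard_mkC`). [cite: Balaban1983Higgs3, (1.21)–(1.22) p.416] -/
noncomputable def autCard (q : IsoClass nbar) : ℕ :=
  Nat.card (TwoLegGraphIso (rep q) (rep q))

/-- kernel: on the class of `T` the symmetry number is `|Aut T|`. [cite: Balaban1983Higgs3, (1.21)–(1.22) p.416] -/
theorem autCard_mkC (T : TwoLegGraph nbar) : autCard (mkC T) = Nat.card (TwoLegGraphIso T T) :=
  card_autTL_eq_of_iso (repIso T)

/-- kernel: the symmetry number of a class is positive. [cite: Balaban1983Higgs3, (1.21)–(1.22) p.416] -/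
theorem autCard_pos (q : IsoClass nbar) : 0 < autCard q :=
  card_twoLegGraphIso_self_pos (rep q)

/-- **THE SYMMETRY NUMBER OF A GLUED CLASS IS THE PRODUCT OF THE SYMMETRY NUMBERS OF THE LETTER CLASSES**: for gen 44's
`glue (c, [c₁, …, c_r])` (the class of the chain of representatives), `autCard = autCard c · Π_i autCard c_i`.
[cite: Balaban1983Higgs3, (1.21)–(1.22) p.416] -/
theorem autCard_glue (c : LetterClass nbar) (cs : List (LetterClass nbar)) :
    autCard (glue (c, cs)).1 = autCard c.1 * (cs.map fun c => autCard c.1).prod := by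
  have hl := isLetter_letter_rep c cs
  show autCard (mkC (chain (rep c.1) (cs.map fun c => rep c.1))) = _
  rw [autCard_mkC, card_aut_chain hl, Fin.prod_univ_succ]
  congr 1
  rw [← List.prod_ofFn]
  congr 1
  refine List.ext_getElem (by simp) fun i h₁ h₂ => ?_
  have hi : i < cs.length := by simpa using h₂
  simp only [List.getElem_ofFn, List.getElem_map, Fin.val_succ]
  rw [letter_rep_succ c cs i hi]
  rfl

/-- **THE SYMMETRY NUMBER OF THE CLASS OF A CONNECTED TWO-POINT INSERTION IS THE PRODUCT OF THE SYMMETRY NUMBERS OF THE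
CLASSES OF ITS ONE-PARTICLE-IRREDUCIBLE PIECES** — through gen 44's index bijection `classEquiv` of the regrouping (1.21):
`autCard x = autCard c₀ · Π_i autCard c_i` where `classEquiv x = (c₀, [c₁, …, c_m])`.
[cite: Balaban1983Higgs3, (1.21)–(1.22) p.416] -/
theorem autCard_eq_prod_classEquiv (x : UnglueableClass nbar) :
    autCard x.1 = autCard (classEquiv x).1.1 * ((classEquiv x).2.map fun c => autCard c.1).prod := by
  conv_lhs => rw [← classEquiv.symm_apply_apply x]
  rw [classEquiv_symm_apply, ← autCard_glue]

/-- kernel: the same read through `classEquiv.symm` — the class glued from `(c₀, [c₁, …, c_r])` has symmetry number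
`autCard c₀ · Π autCard c_i`. [cite: Balaban1983Higgs3, (1.21)–(1.22) p.416] -/
theorem autCard_classEquiv_symm (x : LetterClass nbar × List (LetterClass nbar)) :
    autCard (classEquiv.symm x).1 = autCard x.1.1 * (x.2.map fun c => autCard c.1).prod := by
  rw [classEquiv_symm_apply]
  exact autCard_glue x.1 x.2

end Classes

end Literature.MathematicalPhysics.QuantumFieldTheory.Balaban1983to89.B3OnePIChainAut
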